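import Mathlib.Algebra.Module.Submodule.Map
import Mathlib.Algebra.Module.Submodule.Ker
import Mathlib.Algebra.Module.Submodule.Range
import Mathlib.LinearAlgebra.Prod
import HarnessLib

/-!
# Surjectivity on isotypic kernels: when does a surjection `f : P₁ → P₂` stay surjective between the kernels of `u₁ : P₁ → B₁` and `u₂ : P₂ → B₂`? (cell `b2b-bsdres`, seat additive-p4 gen 43, memo V76 §3 (e) — K128)

HONEST FRAMING (verbatim, cell `b2b-bsdres`): the goal of the cell is to DELETE the COMBINATION-SHAPED
residual classes for ALL analytic-rank `≤ 1` curves over `ℚ` — "full BSD formula for every rank `≤ 1`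
curve in class `C`" assembled STRICTLY from published theorems — so that the rank-`≤ 1` remainder
becomes exactly the CONSTRUCTION-SHAPED classes, which are TYPED (missing-input Props), NOT attempted;
this is not "finishing BSD". This file: TOOL theorems (pure module algebra; 0 defs, 0 facts, nothing
booked; X4 stays CONSTRUCTION-shaped; no mark moves).

## Why

The (b)-half of the θ-rows' END STATE (THETA-ROWS-ENDSTATE §2, Prop. V64-D) consumes (Ihθ): "Ihara for
σ(θ)-forms on the definite algebra at `ℓ₁`", i.e. surjectivity of the `ℓ₁`-degeneracy map `δ` on the
SYNTHEME modules `S₀ = ker(u_* : X_perm → X)` (memo V64 §4.3, V74 §2). What is in print is the statement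
for the FULL modules: Ribet 1990 Thm 3.15 for the Brandt modules `X` (pin THETA §6.2) and — for any
enhanced level structure with `ν(U) = ẑ`, verbatim by strong approximation — for the permutation modules
`X_perm` (Diamond 1997 §3 p. 31, pin THETA §6.10; `det N⁺_ns(3) = 𝔽₃^×`). The passage from `X_perm` to
the isotypic kernels `S₀` is NOT automatic integrally at `3` (over `ℤ[1/3]` the idempotent
`ℤ[synthemes] = 1 ⊕ σ(θ)` splits everything; at `3` it does not — memo V74 §2 (i), K125). This file is
the exact bookkeeping: for a commuting square `u₂ ∘ f = g ∘ u₁` of linear maps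

        P₁ --f--> P₂
        |u₁       |u₂
        B₁ --g--> B₂

* `exists_mem_ker_map_eq_of_ker_le_map_ker` — if `f` is surjective and **`ker g ≤ u₁(ker f)`** then
  `f` maps `ker u₁` ONTO `ker u₂` (every `y ∈ ker u₂` is `f x` with `x ∈ ker u₁`);
* `ker_le_map_ker_of_surjOn_ker` — conversely, if `u₁` is surjective and `f` maps `ker u₁` onto `ker u₂`
  then `ker g ≤ u₁(ker f)`;
* `map_ker_eq_ker_iff` — so, for `f` and `u₁` surjective: **`(ker u₁).map f = ker u₂ ↔ ker g ≤ (ker f).map u₁`**.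

Reading (displayed in memo V76 §3 (e), not here): `P₁ = X_perm(ℓ₁L)`, `P₂ = X_perm(L)²`, `B₁ = X(ℓ₁L)`,
`B₂ = X(L)²`, `f = δ_perm` [onto: Diamond 1997 §3 / strong approximation], `g = δ` [onto: Ribet 3.15],
`u₁, u₂ = u_*` (forget the syntheme) [onto]; then (Ihθ) for `S₀` ⟺ `ker δ ≤ u_*(ker δ_perm)` — "every
relation among `ℓ₁`-old pairs of Brandt divisors lifts to a relation among syntheme-decorated ones" —, a
FINITE statement at each `𝔪`, MEASURED on the six θ-rows by instrument E17c ('S₀-lines', IHARA-mod3-OK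
27/27, gen 37) and not derived here. No number theory enters.
-/

namespace Summit.BirchSwinnertonDyer.Rank1Residual.LevelLowering

variable {R P₁ P₂ B₁ B₂ : Type*} [CommRing R]
  [AddCommGroup P₁] [Module R P₁] [AddCommGroup P₂] [Module R P₂]
  [AddCommGroup B₁] [Module R B₁] [AddCommGroup B₂] [Module R B₂]

/-- If `f` is surjective, the square commutes (`u₂ (f x) = g (u₁ x)`) and `ker g ≤ u₁(ker f)`, then every
`y ∈ ker u₂` is `f x` for some `x ∈ ker u₁`: `f` maps `ker u₁` ONTO `ker u₂`. -/
theorem exists_mem_ker_map_eq_of_ker_le_map_ker (f : P₁ →ₗ[R] P₂) (g : B₁ →ₗ[R] B₂)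
    (u₁ : P₁ →ₗ[R] B₁) (u₂ : P₂ →ₗ[R] B₂) (hcomm : ∀ x, u₂ (f x) = g (u₁ x))
    (hf : Function.Surjective f) (hker : LinearMap.ker g ≤ (LinearMap.ker f).map u₁)
    {y : P₂} (hy : y ∈ LinearMap.ker u₂) : ∃ x ∈ LinearMap.ker u₁, f x = y := by
  obtain ⟨x, rfl⟩ := hf y
  have hgx : u₁ x ∈ LinearMap.ker g := by
    rw [LinearMap.mem_ker, ← hcomm]; exact hy
  obtain ⟨x', hx', hux⟩ := hker hgx
  refine ⟨x - x', ?_, ?_⟩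
  · rw [LinearMap.mem_ker, map_sub, hux, sub_self]
  · rw [map_sub, LinearMap.mem_ker.mp hx', sub_zero]

/-- The same, as an equality of submodules: `(ker u₁).map f = ker u₂` (the inclusion `≤` is the
commutativity of the square alone). -/
theorem map_ker_eq_ker_of_ker_le_map_ker (f : P₁ →ₗ[R] P₂) (g : B₁ →ₗ[R] B₂)
    (u₁ : P₁ →ₗ[R] B₁) (u₂ : P₂ →ₗ[R] B₂) (hcomm : ∀ x, u₂ (f x) = g (u₁ x))
    (hf : Function.Surjective f) (hker : LinearMap.ker g ≤ (LinearMap.ker f).map u₁) :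
    (LinearMap.ker u₁).map f = LinearMap.ker u₂ := by
  apply le_antisymm
  · rintro _ ⟨x, hx, rfl⟩
    rw [SetLike.mem_coe, LinearMap.mem_ker] at hx
    rw [LinearMap.mem_ker, hcomm, hx, map_zero]
  · intro y hy
    obtain ⟨x, hx, rfl⟩ := exists_mem_ker_map_eq_of_ker_le_map_ker f g u₁ u₂ hcomm hf hker hy
    exact ⟨x, hx, rfl⟩

/-- Conversely: if `u₁` is surjective, the square commutes and `f` maps `ker u₁` onto `ker u₂`, then
`ker g ≤ u₁(ker f)`. -/
theorem ker_le_map_ker_of_surjOn_ker (f : P₁ →ₗ[R] P₂) (g : B₁ →ₗ[R] B₂)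
    (u₁ : P₁ →ₗ[R] B₁) (u₂ : P₂ →ₗ[R] B₂) (hcomm : ∀ x, u₂ (f x) = g (u₁ x))
    (hu : Function.Surjective u₁) (hsurj : LinearMap.ker u₂ ≤ (LinearMap.ker u₁).map f) :
    LinearMap.ker g ≤ (LinearMap.ker f).map u₁ := by
  intro b hb
  obtain ⟨x, rfl⟩ := hu b
  have hfx : f x ∈ LinearMap.ker u₂ := by
    rw [LinearMap.mem_ker, hcomm]; exact hb
  obtain ⟨x'', hx'', hfx''⟩ := hsurj hfx
  refine ⟨x - x'', ?_, ?_⟩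
  · rw [SetLike.mem_coe, LinearMap.mem_ker, map_sub, hfx'', sub_self]
  · rw [map_sub, LinearMap.mem_ker.mp hx'', sub_zero]

/-- **THE BOOKKEEPING OF (Ihθ).** For a commuting square with `f` and `u₁` surjective:
`f` maps `ker u₁` onto `ker u₂` **iff** `ker g ≤ u₁(ker f)`. (Reading: Ihara for the syntheme parts
`S₀` ⟺ every relation among `ℓ₁`-old pairs of Brandt divisors lifts to one among syntheme-decorated
divisors; memo V76 §3 (e).) -/
theorem map_ker_eq_ker_iff (f : P₁ →ₗ[R] P₂) (g : B₁ →ₗ[R] B₂)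
    (u₁ : P₁ →ₗ[R] B₁) (u₂ : P₂ →ₗ[R] B₂) (hcomm : ∀ x, u₂ (f x) = g (u₁ x))
    (hf : Function.Surjective f) (hu : Function.Surjective u₁) :
    (LinearMap.ker u₁).map f = LinearMap.ker u₂ ↔
      LinearMap.ker g ≤ (LinearMap.ker f).map u₁ := by
  constructor
  · intro h
    exact ker_le_map_ker_of_surjOn_ker f g u₁ u₂ hcomm hu h.ge
  · exact map_ker_eq_ker_of_ker_le_map_ker f g u₁ u₂ hcomm hf

/-- A checkable sufficient condition: if `ker g` lies in the span of a family `b i` each of which LIFTS to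
`ker f` along `u₁` (`b i = u₁ x` with `f x = 0`), then `ker g ≤ u₁(ker f)`. (This is the form an instrument
verifies: lift a spanning set of `ℓ₁`-old relations.) -/
theorem ker_le_map_ker_of_span_lifts (f : P₁ →ₗ[R] P₂) (g : B₁ →ₗ[R] B₂) (u₁ : P₁ →ₗ[R] B₁)
    {ι : Type*} (b : ι → B₁) (hspan : LinearMap.ker g ≤ Submodule.span R (Set.range b))
    (hlift : ∀ i, ∃ x ∈ LinearMap.ker f, u₁ x = b i) :
    LinearMap.ker g ≤ (LinearMap.ker f).map u₁ := by
  refine le_trans hspan (Submodule.span_le.mpr ?_)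
  rintro _ ⟨i, rfl⟩
  obtain ⟨x, hx, hux⟩ := hlift i
  exact ⟨x, hx, hux⟩

end Summit.BirchSwinnertonDyer.Rank1Residual.LevelLowering
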